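import Summits.Ventures.CertifiedManyBodySolver.Transport.ChainWindowMidpoint
import Summits.Ventures.CertifiedManyBodySolver.Transport.ChainWindowBlocks
import HarnessLib

/-!
# Ventures/CertifiedManyBodySolver — Transport/ChainWindowReflection.lean

Speedrun cell sr-mbsolver — LIT team (lit-1 gen-7), LEAD r118 (c) "STAGE 3", part B2a: THE CHAIN REFLECTION (site-permutation part).
HONEST FRAMING: first certified bounds; not a superconductivity verdict; every number certified or labelled float.

The second generator of op-08's identification group is the reflection `p ↦ k−1−p` of the `k = n+3` window positions
(`code/oplayer/fockspace.py`: `reflection`), i.e. `x ↦ n − x` on the window `{-1, …, n+1}`. Its Fock unitary is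
`(sector sign) · (site permutation) · (⨂_x diag(1,1,1,−1))` (the Jordan–Wigner reordering sign of a reflected occupation list is
`(−1)^{#pairs of particles on distinct sites} = (−1)^{N(N−1)/2} · (−1)^{#doubly occupied sites}`); this file treats the SITE-PERMUTATION
factor `P = permOp r`: the reflection `chainReflect a b : y ↦ a + b − y` of a chain window as a site bijection, how it intertwines
the two sub-window embeddings of the local-translation-invariance row (`incl ≫ r = r₀ ≫ (shift ∘ incl)` and
`(shift ∘ incl) ≫ r = r₀ ≫ incl`, `r₀` the reflection of the sub-window), and hence that conjugation by `P` PRESERVES the rows of the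
ENT / `tl_marginal` node that involve partial traces — local translation invariance (the two marginals of `PσPᴴ` are the REFLECTED
marginals of `σ`, equal by the LTI row of `σ`) and the entropy row (the marginal entropy is a relabelling invariant) — as well as the
sector zeros, reality, positivity, trace, and the site-averaged density; products of on-site factors are carried to the reflected
sites (`reflect_conj_onSite_mul_onSite`), which part B2b combines with the on-site sign `diag(1,1,1,−1)` to show that the bond-averaged
objective `h_avg` is reflection invariant. No sorry, no axiom; the one definition is the site bijection `chainReflect` (with body).
[cite: KullEtAl2024, §II.B eq. (locTIn), §VI.B] [cite: BratteliRobinsonII1997, §6.2.1] [cite: FawziFawziScalet2024Entropy, Theorem 4.1]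
-/

noncomputable section

open Matrix Complex
open scoped ComplexOrder BigOperators
open Literature.Probability.LatticeModels
open Literature.MathematicalPhysics.QuantumLattice
open Literature.MathematicalPhysics.QuantumLattice.HubbardWave0
open Literature.MathematicalPhysics.QuantumLattice.JordanWigner
open Literature.InformationTheory.Entropy (vonNeumannEntropy vonNeumannEntropy_unitary_conj)

namespace Summit.Ventures.CertifiedManyBodySolver.Transport

/-! ### §1 The reflection of a chain window as a site bijection -/

section Geometry

/-- `a + b − x ∈ {a, …, b}` for `x ∈ {a, …, b}`. [folklore] -/
theorem reflect_mem_chainWindow {a b : ℤ} {x : Site 1} (hx : x ∈ chainWindow a b) :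
    (fun _ => a + b - x 0 : Site 1) ∈ chainWindow a b := by
  rw [mem_chainWindow] at hx ⊢
  omega

/-- **The reflection `y ↦ a + b − y` of the chain window `{a, …, b}`** (an involutive site bijection). For op-08's
`k`-site window `{-1, …, n+1}` this is fockspace's `reflection : p ↦ k − 1 − p` on positions `p = y + 1`. [folklore] -/
def chainReflect (a b : ℤ) : PolySite (chainWindow a b) ≃ PolySite (chainWindow a b) where
  toFun y := PolySite.pt (fun _ => a + b - ofLex y.1 0) (reflect_mem_chainWindow (PolySite.ofLex_mem y))
  invFun y := PolySite.pt (fun _ => a + b - ofLex y.1 0) (reflect_mem_chainWindow (PolySite.ofLex_mem y))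
  left_inv y := by
    refine Subtype.ext ?_
    show toLex (fun _ => a + b - (a + b - ofLex y.1 0) : Site 1) = y.1
    have h : (fun _ => a + b - (a + b - ofLex y.1 0) : Site 1) = ofLex y.1 :=
      funext fun i => by rw [Subsingleton.elim i 0]; ring
    rw [h]
    rfl
  right_inv y := by
    refine Subtype.ext ?_
    show toLex (fun _ => a + b - (a + b - ofLex y.1 0) : Site 1) = y.1
    have h : (fun _ => a + b - (a + b - ofLex y.1 0) : Site 1) = ofLex y.1 :=
      funext fun i => by rw [Subsingleton.elim i 0]; ring
    rw [h]
    rfl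

/-- The reflected site: `(r y)₀ = a + b − y₀`. [folklore] -/
@[simp] theorem chainReflect_apply_zero (a b : ℤ) (y : PolySite (chainWindow a b)) :
    ofLex (chainReflect a b y).1 0 = a + b - ofLex y.1 0 := rfl

/-- The reflection is an involution: `r⁻¹ = r`. [folklore] -/
theorem chainReflect_symm (a b : ℤ) : (chainReflect a b).symm = chainReflect a b := rfl

variable (n : ℕ)

/-- **The reflection carries the left sub-window embedding to the shifted one**: for `W = {-1,…,n+1}`, `W₀ = {-1,…,n}`,
`incl_{W₀ ⊆ W} ≫ r_W = r_{W₀} ≫ (x ↦ x+1)`: reflecting the first `n+2` sites gives the last `n+2` sites, read backwards. [folklore] -/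
theorem incl_trans_chainReflect :
    (PolySite.incl (chainWindow_mono_right (-1) (by omega : (n : ℤ) ≤ n + 1))).trans (chainReflect (-1) ((n : ℤ) + 1)).toEmbedding =
      (chainReflect (-1) (n : ℤ)).toEmbedding.trans ((PolySite.affEmb 1 (unitVec 0) (chainWindow (-1) (n : ℤ))).trans
        (PolySite.incl (affShiftSet_chainWindow_subset (-1) (n : ℤ)))) := by
  ext y : 1
  refine polySite_eq_of_coord_eq ?_
  simp only [Function.Embedding.trans_apply, Equiv.coe_toEmbedding, chainReflect_apply_zero, PolySite.coe_incl,
    PolySite.ofLex_coe_affEmb, affSite_apply, Units.val_one, one_mul, unitVec, Pi.single_eq_same]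
  ring

/-- **The reflection carries the shifted sub-window embedding to the left one**: `(x ↦ x+1) ≫ r_W = r_{W₀} ≫ incl_{W₀ ⊆ W}`. [folklore] -/
theorem affEmb_trans_chainReflect :
    ((PolySite.affEmb 1 (unitVec 0) (chainWindow (-1) (n : ℤ))).trans
        (PolySite.incl (affShiftSet_chainWindow_subset (-1) (n : ℤ)))).trans (chainReflect (-1) ((n : ℤ) + 1)).toEmbedding =
      (chainReflect (-1) (n : ℤ)).toEmbedding.trans (PolySite.incl (chainWindow_mono_right (-1) (by omega : (n : ℤ) ≤ n + 1))) := by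
  ext y : 1
  refine polySite_eq_of_coord_eq ?_
  simp only [Function.Embedding.trans_apply, Equiv.coe_toEmbedding, chainReflect_apply_zero, PolySite.coe_incl,
    PolySite.ofLex_coe_affEmb, affSite_apply, Units.val_one, one_mul, unitVec, Pi.single_eq_same]
  ring

end Geometry

/-! ### §2 The site-permutation unitary `P = permOp r` preserves the rows -/

section Rows

variable (n : ℕ)

/-- **The LTI row survives the reflection**: both marginals of `P σ Pᴴ` are the reflected (`r₀`-relabelled) marginals of `σ`, which
agree by the LTI row of `σ`. [cite: KullEtAl2024, §II.B eq. (locTIn)] [cite: BratteliRobinsonII1997, §6.2.1] -/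
theorem reflect_ltiRow {σ : Op (PolySite (chainWindow (-1) ((n : ℤ) + 1))) 4}
    (hLTI : spinPartialTrace ((PolySite.affEmb 1 (unitVec 0) (chainWindow (-1) (n : ℤ))).trans
        (PolySite.incl (affShiftSet_chainWindow_subset (-1) (n : ℤ)))) σ =
      spinPartialTrace (PolySite.incl (chainWindow_mono_right (-1) (by omega : (n : ℤ) ≤ n + 1))) σ) :
    spinPartialTrace ((PolySite.affEmb 1 (unitVec 0) (chainWindow (-1) (n : ℤ))).trans
        (PolySite.incl (affShiftSet_chainWindow_subset (-1) (n : ℤ))))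
        (permOp (chainReflect (-1) ((n : ℤ) + 1)) * σ * (permOp (chainReflect (-1) ((n : ℤ) + 1)))ᴴ) =
      spinPartialTrace (PolySite.incl (chainWindow_mono_right (-1) (by omega : (n : ℤ) ≤ n + 1)))
        (permOp (chainReflect (-1) ((n : ℤ) + 1)) * σ * (permOp (chainReflect (-1) ((n : ℤ) + 1)))ᴴ) := by
  rw [spinPartialTrace_permOp_mul_mul_conjTranspose, spinPartialTrace_permOp_mul_mul_conjTranspose, chainReflect_symm,
    affEmb_trans_chainReflect, incl_trans_chainReflect, spinPartialTrace_trans, spinPartialTrace_trans, hLTI]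

/-- **The marginal of the reflected state is the relabelled marginal**: `tr_{n+1} (PσPᴴ) = r₀ · (tr_{n+1} σ)` under the LTI row.
[cite: BratteliRobinsonII1997, §6.2.1] -/
theorem spinPartialTrace_incl_reflect_conj {σ : Op (PolySite (chainWindow (-1) ((n : ℤ) + 1))) 4}
    (hLTI : spinPartialTrace ((PolySite.affEmb 1 (unitVec 0) (chainWindow (-1) (n : ℤ))).trans
        (PolySite.incl (affShiftSet_chainWindow_subset (-1) (n : ℤ)))) σ =
      spinPartialTrace (PolySite.incl (chainWindow_mono_right (-1) (by omega : (n : ℤ) ≤ n + 1))) σ) :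
    spinPartialTrace (PolySite.incl (chainWindow_mono_right (-1) (by omega : (n : ℤ) ≤ n + 1)))
        (permOp (chainReflect (-1) ((n : ℤ) + 1)) * σ * (permOp (chainReflect (-1) ((n : ℤ) + 1)))ᴴ) =
      reindexOp (chainReflect (-1) (n : ℤ)).symm
        (spinPartialTrace (PolySite.incl (chainWindow_mono_right (-1) (by omega : (n : ℤ) ≤ n + 1))) σ) := by
  rw [spinPartialTrace_permOp_mul_mul_conjTranspose, chainReflect_symm, incl_trans_chainReflect, spinPartialTrace_trans, hLTI,
    spinPartialTrace_equiv]

/-- **The entropy row survives the reflection** (given the LTI row of `σ`): `S(PσPᴴ) − S(tr_{n+1}(PσPᴴ)) = S(σ) − S(tr_{n+1} σ)`.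
[cite: FawziFawziScalet2024Entropy, Theorem 4.1] [cite: NielsenChuang2010, Theorem 11.8 (3)] -/
theorem reflect_entropyRow {σ : Op (PolySite (chainWindow (-1) ((n : ℤ) + 1))) 4} (hσ : σ.IsHermitian)
    (hLTI : spinPartialTrace ((PolySite.affEmb 1 (unitVec 0) (chainWindow (-1) (n : ℤ))).trans
        (PolySite.incl (affShiftSet_chainWindow_subset (-1) (n : ℤ)))) σ =
      spinPartialTrace (PolySite.incl (chainWindow_mono_right (-1) (by omega : (n : ℤ) ≤ n + 1))) σ) :
    vonNeumannEntropy (permOp (chainReflect (-1) ((n : ℤ) + 1)) * σ * (permOp (chainReflect (-1) ((n : ℤ) + 1)))ᴴ) -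
        vonNeumannEntropy (spinPartialTrace (PolySite.incl (chainWindow_mono_right (-1) (by omega : (n : ℤ) ≤ n + 1)))
          (permOp (chainReflect (-1) ((n : ℤ) + 1)) * σ * (permOp (chainReflect (-1) ((n : ℤ) + 1)))ᴴ)) =
      vonNeumannEntropy σ -
        vonNeumannEntropy (spinPartialTrace (PolySite.incl (chainWindow_mono_right (-1) (by omega : (n : ℤ) ≤ n + 1))) σ) := by
  rw [spinPartialTrace_incl_reflect_conj n hLTI, vonNeumannEntropy_reindexOp _ (isHermitian_spinPartialTrace _ hσ),
    vonNeumannEntropy_unitary_conj (permOp_mem_unitaryGroup _) hσ]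

variable {Y : Type} [Fintype Y] [DecidableEq Y]

omit [DecidableEq Y] in
/-- `permOp e` is a signed permutation of configurations with all signs `+1`. [folklore] -/
theorem permOp_apply' (e : Y ≃ Y) (k l : TensorIndex Y 4) :
    permOp e k l = if l = (fun x => k (e x)) then (fun _ : TensorIndex Y 4 => (1 : ℂ)) k else 0 :=
  permOp_apply e k l

omit [DecidableEq Y] in
/-- A site bijection does not change the count `N_σ` of a configuration. [folklore] -/
theorem sectorCount_comp_equiv (e : Y ≃ Y) (σ : Fin 2) (k : TensorIndex Y 4) :
    (∑ x, if σ ∈ siteOcc (k (e x)) then 1 else 0 : ℕ) = ∑ x, if σ ∈ siteOcc (k x) then 1 else 0 :=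
  e.sum_comp (fun x => if σ ∈ siteOcc (k x) then 1 else 0)

/-- **Sector zeros survive a site permutation.** [folklore] -/
theorem permOp_sectorRow (e : Y ≃ Y) {ρ : Op Y 4}
    (hρ : ∀ σ : Fin 2, ∀ k k' : TensorIndex Y 4,
      (∑ x, if σ ∈ siteOcc (k x) then 1 else 0 : ℕ) ≠ (∑ x, if σ ∈ siteOcc (k' x) then 1 else 0 : ℕ) → ρ k k' = 0)
    (σ : Fin 2) (k k' : TensorIndex Y 4)
    (hk : (∑ x, if σ ∈ siteOcc (k x) then 1 else 0 : ℕ) ≠ (∑ x, if σ ∈ siteOcc (k' x) then 1 else 0 : ℕ)) :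
    ((permOp e : Op Y 4) * ρ * (permOp e : Op Y 4)ᴴ) k k' = 0 := by
  refine sectorRow_signedPerm_conj (fun k x => k (e x)) _ (permOp_apply' e)
    (fun (σ : Fin 2) (k : TensorIndex Y 4) => (∑ x, if σ ∈ siteOcc (k x) then 1 else 0 : ℕ)) ?_ hρ σ k k' hk
  intro τ l l' hl
  exact ⟨τ, by rwa [sectorCount_comp_equiv, sectorCount_comp_equiv]⟩

/-- **Real entries survive a site permutation.** [folklore] -/
theorem permOp_realRow (e : Y ≃ Y) {ρ : Op Y 4} (hρ : ∀ k k', starRingEnd ℂ (ρ k k') = ρ k k') (k k' : TensorIndex Y 4) :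
    starRingEnd ℂ (((permOp e : Op Y 4) * ρ * (permOp e : Op Y 4)ᴴ) k k') =
      ((permOp e : Op Y 4) * ρ * (permOp e : Op Y 4)ᴴ) k k' :=
  realRow_signedPerm_conj _ _ (permOp_apply' e) (fun _ => star_one ℂ) hρ k k'

/-- **A site permutation carries a product of on-site factors to the permuted sites.** [cite: BratteliRobinsonII1997, §6.2.1] -/
theorem reflect_conj_onSite_mul_onSite (e : Y ≃ Y) (x y : Y) (a b : Matrix (Fin 4) (Fin 4) ℂ) :
    permOp e * (onSite x a * onSite y b) * (permOp e)ᴴ = onSite (e x) a * onSite (e y) b := by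
  rw [permOp_mul_mul_conjTranspose, map_mul, reindexOp_onSite, reindexOp_onSite]

/-- `P (onSite x a) Pᴴ = onSite (e x) a` (recorded). [cite: BratteliRobinsonII1997, §6.2.1] -/
theorem reflect_conj_onSite (e : Y ≃ Y) (x : Y) (a : Matrix (Fin 4) (Fin 4) ℂ) :
    permOp e * onSite x a * (permOp e)ᴴ = onSite (e x) a :=
  permOp_mul_onSite_mul_conjTranspose e x a

/-- **The site-averaged density is permutation invariant**: `P · toSpin (tlmDensity n) · Pᴴ = toSpin (tlmDensity n)`.
[cite: KullEtAl2024, §II.B] -/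
theorem reflect_conj_toSpin_tlmDensity (e : PolySite (chainWindow (-1) ((n : ℤ) + 1)) ≃ PolySite (chainWindow (-1) ((n : ℤ) + 1))) :
    permOp e * toSpin (tlmDensity n) * (permOp e)ᴴ = toSpin (tlmDensity n) := by
  rw [tlmDensity, map_smul, map_sum, Matrix.mul_smul, Matrix.smul_mul, Finset.mul_sum, Finset.sum_mul]
  congr 1
  have h : ∀ p : PolySite (chainWindow (-1) ((n : ℤ) + 1)),
      permOp e * toSpin (∑ σ : Fin 2, numberOp p σ) * (permOp e)ᴴ = toSpin (∑ σ : Fin 2, numberOp (e p) σ) := by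
    intro p
    rw [map_sum, map_sum, Finset.mul_sum, Finset.sum_mul]
    refine Finset.sum_congr rfl fun σ _ => ?_
    rw [toSpin_numberOp, toSpin_numberOp, reflect_conj_onSite]
  simp_rw [h]
  exact e.sum_comp (fun p => toSpin (∑ σ : Fin 2, numberOp p σ))

/-- `P² = 1` for an involution `e` (`e.symm = e`). [folklore] -/
theorem permOp_mul_self_of_symm_eq (e : Y ≃ Y) (he : e.symm = e) : (permOp e : Op Y 4) * permOp e = 1 := by
  calc (permOp e : Op Y 4) * permOp e = permOp e * (permOp e)ᴴ := by rw [conjTranspose_permOp, he]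
    _ = 1 := permOp_mul_conjTranspose e

end Rows

end Summit.Ventures.CertifiedManyBodySolver.Transport
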